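import Mathlib.RingTheory.SimpleModule.Isotypic
import Mathlib.RepresentationTheory.Maschke
import Literature.NumberTheory.GaloisRepresentations.WeilDeligneDominance
import Literature.RepresentationTheory.Semisimple.SubrepresentationEquiv
import Literature.RepresentationTheory.GeneralLinear.MatrixRepBaseChange
import HarnessLib

/-!
# The canonical (isotypic) decomposition of a semisimple representation, for `repIsotypic`

J.-P. Serre, *Linear Representations of Finite Groups*, GTM 42 (Springer, 1977), §2.6
"Canonical decomposition of a representation", Theorem 8 (p. 21): a completely reducible
representation is the direct sum `V = V₁ ⊕ ⋯ ⊕ V_h` of its isotypic components, `V_i` the sum of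
the irreducible subrepresentations isomorphic to `W_i`, the `W_i` pairwise non-isomorphic.  Used by
J. Bellaïche, G. Chenevier, Astérisque 324 (2009), §7.8 (arXiv:math/0602340 p. 111) for `ρ|_{I_F}`
of a Weil–Deligne representation ("each of its isotypic component is preserved by `N`").

What is reproduced here, for the tree's `θ`-part
`Literature.NumberTheory.GaloisRepresentations.repIsotypic θ σ = Σ_{f : θ → σ} im f`
(accepted `WeilDeligneDominance`) over any field `C` and any group `G` (all proved, no named
facts), through the dictionary with Mathlib's isotypic components of the `C[G]`-module
`σ.asModule` (`Mathlib.RingTheory.SimpleModule.Isotypic`):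

* `repIsotypic_eq_toSubmodule_isotypicComponent` — for irreducible `θ`, `repIsotypic θ σ` is
  `isotypicComponent C[G] σ.asModule θ.asModule` read in `V` (via `Subrepresentation.ofSubmodule'`);
* `iSupIndep_repIsotypic` — the `θᵢ`-parts, `θᵢ` irreducible pairwise non-isomorphic, of ANY
  representation are independent (Theorem 8, uniqueness half);
* `exists_repIsotypic_iSup_eq_top` — a finite-dimensional semisimple representation is the sum
  of finitely many `θᵢ`-parts, `θᵢ` irreducible, pairwise non-isomorphic, modelled on
  `Fin dᵢ → C`, each trivial wherever `σ` is (Theorem 8, existence half);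
* `finrank_iSup_eq_sum_of_iSupIndep`, `finrank_range_eq_sum_finrank_map_of_iSup_eq_top`,
  `sum_finrank_map_le_finrank_range` — `dim ⊕ Uᵢ = Σ dim Uᵢ` and `rk T = Σᵢ dim T(Uᵢ)` for an
  endomorphism `T` preserving an independent decomposition;
* `Representation.isSemisimpleRepresentation_of_finite_range_asGroupHom` — Maschke for a
  representation with finite image over a field of characteristic `0` (the accepted
  `WeilDeligneRep.isSemisimpleRepresentation_of_finite_range` is the case `C = ℂ`).

## References

* J.-P. Serre, *Linear Representations of Finite Groups*, GTM 42 (1977), §2.6 Thm. 8 (p. 21),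
  §1.3 Thm. 1 (Maschke: stable complements), §1.4 Thm. 2. [Serre1977]
* J. Bellaïche, G. Chenevier, Astérisque 324 (2009), §7.8 (arXiv:math/0602340 p. 111).
  [BellaicheChenevier2009]
-/

noncomputable section

open Module
open scoped MonoidAlgebra

namespace Literature.NumberTheory.GaloisRepresentations

universe u

/-! ### Dimension of an independent finite sum; rank of an endomorphism preserving it -/

section LinearAlgebra

variable {K : Type*} [DivisionRing K] {V : Type*} [AddCommGroup V] [Module K V]

/-- `dim (⨆ᵢ Uᵢ) = Σᵢ dim Uᵢ` for an independent finite family of subspaces of a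
finite-dimensional space (induction on a `Finset`, `dim (A + B) + dim (A ∩ B) = dim A + dim B`).
[folklore] -/
theorem finrank_iSup_eq_sum_of_iSupIndep [FiniteDimensional K V] {ι : Type*} [Fintype ι]
    {U : ι → Submodule K V} (hU : iSupIndep U) :
    finrank K ↥(⨆ i, U i) = ∑ i, finrank K (U i) := by
  classical
  suffices h : ∀ s : Finset ι, finrank K ↥(⨆ i ∈ s, U i) = ∑ i ∈ s, finrank K (U i) by
    have h' := h Finset.univ
    rwa [show (⨆ i ∈ (Finset.univ : Finset ι), U i) = ⨆ i, U i by simp] at h'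
  intro s
  induction s using Finset.induction_on with
  | empty => simp
  | insert a s ha ih =>
    rw [Finset.iSup_insert, Finset.sum_insert ha, ← ih]
    have hdisj : Disjoint (U a) (⨆ i ∈ s, U i) := by
      have h := hU.disjoint_biSup (x := a) (y := (↑s : Set ι)) (by simpa using ha)
      simpa using h
    have h := Submodule.finrank_sup_add_finrank_inf_eq (U a) (⨆ i ∈ s, U i)
    rwa [hdisj.eq_bot, finrank_bot, add_zero] at h

/-- **`rk T = Σᵢ dim T(Uᵢ)`** for an endomorphism `T` preserving each member of an independent
family `(Uᵢ)` with `⨆ᵢ Uᵢ = V` (the `T(Uᵢ) ≤ Uᵢ` are again independent and sum to `T(V)`).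
[folklore] -/
theorem finrank_range_eq_sum_finrank_map_of_iSup_eq_top [FiniteDimensional K V] {ι : Type*}
    [Fintype ι] {U : ι → Submodule K V} (hU : iSupIndep U) (htop : ⨆ i, U i = ⊤)
    (T : V →ₗ[K] V) (hT : ∀ i, (U i).map T ≤ U i) :
    finrank K ↥(LinearMap.range T) = ∑ i, finrank K ↥((U i).map T) := by
  have hind : iSupIndep fun i => (U i).map T := hU.mono fun i => hT i
  rw [← finrank_iSup_eq_sum_of_iSupIndep hind, ← Submodule.map_iSup, htop, Submodule.map_top]

/-- `Σᵢ dim T(Uᵢ) ≤ rk T` for an endomorphism `T` preserving each member of an independent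
family `(Uᵢ)`. [folklore] -/
theorem sum_finrank_map_le_finrank_range [FiniteDimensional K V] {ι : Type*} [Fintype ι]
    {U : ι → Submodule K V} (hU : iSupIndep U) (T : V →ₗ[K] V) (hT : ∀ i, (U i).map T ≤ U i) :
    ∑ i, finrank K ↥((U i).map T) ≤ finrank K ↥(LinearMap.range T) := by
  have hind : iSupIndep fun i => (U i).map T := hU.mono fun i => hT i
  rw [← finrank_iSup_eq_sum_of_iSupIndep hind, ← Submodule.map_iSup]
  exact Submodule.finrank_mono (LinearMap.map_le_range)

end LinearAlgebra

/-! ### `C[G]`-submodules of `σ.asModule` read in `V` (Mathlib's `Subrepresentation.ofSubmodule'`) -/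

section Dictionary

variable {C : Type*} [Field C] {G : Type*} [Group G]
  {V : Type*} [AddCommGroup V] [Module C V]

/-- Membership in the underlying subspace `(Subrepresentation.ofSubmodule' X).toSubmodule ≤ V`
of a `C[G]`-submodule `X ≤ σ.asModule` is membership in `X` read through `σ.asModuleEquiv` (the
identity). [folklore] -/
theorem mem_toSubmodule_ofSubmodule'_iff (σ : Representation C G V)
    (X : Submodule C[G] σ.asModule) (v : V) :
    v ∈ (Subrepresentation.ofSubmodule' X).toSubmodule ↔ σ.asModuleEquiv.symm v ∈ X :=
  Iff.rfl

/-- `X ↦ (ofSubmodule' X).toSubmodule` preserves arbitrary joins (an element of `⨆ Xᵢ` is a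
finite sum of elements of the `Xᵢ`). [folklore] -/
theorem toSubmodule_ofSubmodule'_iSup (σ : Representation C G V) {ι : Sort*}
    (X : ι → Submodule C[G] σ.asModule) :
    (Subrepresentation.ofSubmodule' (⨆ i, X i)).toSubmodule =
      ⨆ i, (Subrepresentation.ofSubmodule' (X i)).toSubmodule := by
  refine le_antisymm (fun v hv => ?_) (iSup_le fun i => ?_)
  · rw [mem_toSubmodule_ofSubmodule'_iff] at hv
    have h := Submodule.iSup_induction X
      (motive := fun x : σ.asModule =>
        σ.asModuleEquiv x ∈ ⨆ i, (Subrepresentation.ofSubmodule' (X i)).toSubmodule) hv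
      (fun i x hx => Submodule.mem_iSup_of_mem i
        ((mem_toSubmodule_ofSubmodule'_iff σ (X i) _).mpr (by simpa using hx)))
      (by rw [map_zero]; exact Submodule.zero_mem _)
      (fun x y hx hy => by rw [map_add]; exact Submodule.add_mem _ hx hy)
    rwa [LinearEquiv.apply_symm_apply] at h
  · intro v hv
    rw [mem_toSubmodule_ofSubmodule'_iff] at hv ⊢
    exact Submodule.mem_iSup_of_mem i hv

/-- `X ↦ (ofSubmodule' X).toSubmodule` preserves binary meets (same carrier). [folklore] -/
theorem toSubmodule_ofSubmodule'_inf (σ : Representation C G V)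
    (X Y : Submodule C[G] σ.asModule) :
    (Subrepresentation.ofSubmodule' (X ⊓ Y)).toSubmodule =
      (Subrepresentation.ofSubmodule' X).toSubmodule ⊓
        (Subrepresentation.ofSubmodule' Y).toSubmodule :=
  rfl

/-- `X ↦ (ofSubmodule' X).toSubmodule` sends `⊥` to `⊥`. [folklore] -/
theorem toSubmodule_ofSubmodule'_bot (σ : Representation C G V) :
    (Subrepresentation.ofSubmodule' (⊥ : Submodule C[G] σ.asModule)).toSubmodule = ⊥ :=
  (Submodule.eq_bot_iff _).mpr fun v hv => by
    rw [mem_toSubmodule_ofSubmodule'_iff, Submodule.mem_bot] at hv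
    simpa using congrArg σ.asModuleEquiv hv

/-- `X ↦ (ofSubmodule' X).toSubmodule` sends `⊤` to `⊤`. [folklore] -/
theorem toSubmodule_ofSubmodule'_top (σ : Representation C G V) :
    (Subrepresentation.ofSubmodule' (⊤ : Submodule C[G] σ.asModule)).toSubmodule = ⊤ :=
  Submodule.eq_top_iff'.mpr fun v =>
    (mem_toSubmodule_ofSubmodule'_iff σ ⊤ v).mpr Submodule.mem_top

/-- `X ↦ (ofSubmodule' X).toSubmodule` carries independent families to independent families
(it preserves `⨆`, `⊓` and `⊥`). [folklore] -/
theorem iSupIndep.toSubmodule_ofSubmodule' (σ : Representation C G V) {ι : Type*}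
    {X : ι → Submodule C[G] σ.asModule} (h : iSupIndep X) :
    iSupIndep fun i => (Subrepresentation.ofSubmodule' (X i)).toSubmodule := by
  intro i
  have hi := h i
  rw [disjoint_iff] at hi ⊢
  have key : (Subrepresentation.ofSubmodule' (X i)).toSubmodule ⊓
      ⨆ j, ⨆ (_ : j ≠ i), (Subrepresentation.ofSubmodule' (X j)).toSubmodule =
      (Subrepresentation.ofSubmodule' (X i ⊓ ⨆ j, ⨆ (_ : j ≠ i), X j)).toSubmodule := by
    rw [toSubmodule_ofSubmodule'_inf, toSubmodule_ofSubmodule'_iSup]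
    simp only [toSubmodule_ofSubmodule'_iSup]
  rw [key, hi, toSubmodule_ofSubmodule'_bot]

variable {Vθ : Type*} [AddCommGroup Vθ] [Module C Vθ]

/-- **The `θ`-part is the isotypic component.**  For an irreducible representation `θ` of `G`,
the tree's `repIsotypic θ σ = Σ_{f : θ → σ equivariant} im f` is Mathlib's isotypic component
`isotypicComponent C[G] σ.asModule θ.asModule` (the sum of the `C[G]`-submodules isomorphic to
the simple module `θ.asModule`) read in `V`: a non-zero equivariant `f` is injective (Schur), so
`im f ≅ θ`, and a submodule `m ≅ θ.asModule` is the image of `θ ≅ m ⊆ σ`. [folklore] -/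
theorem repIsotypic_eq_toSubmodule_isotypicComponent (θ : Representation C G Vθ)
    [θ.IsIrreducible] (σ : Representation C G V) :
    repIsotypic θ σ = (Subrepresentation.ofSubmodule'
      (isotypicComponent C[G] σ.asModule θ.asModule)).toSubmodule := by
  apply le_antisymm
  · refine iSup_le fun f => ?_
    rintro _ ⟨x, rfl⟩
    rw [mem_toSubmodule_ofSubmodule'_iff]
    let F : θ.asModule →ₗ[C[G]] σ.asModule :=
      Representation.IntertwiningMap.equivLinearMapAsModule θ σ f
    have h1 : LinearMap.range F ≤ isotypicComponent C[G] σ.asModule θ.asModule := by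
      haveI : IsSimpleModule C[G] (⊤ : Submodule C[G] θ.asModule) :=
        IsSimpleModule.congr Submodule.topEquiv
      rw [LinearMap.range_eq_map, ← Submodule.topEquiv.isotypicComponent_eq]
      exact Submodule.map_le_isotypicComponent ⊤ F
    exact h1 ⟨θ.asModuleEquiv.symm x, rfl⟩
  · rw [isotypicComponent, sSup_eq_iSup', toSubmodule_ofSubmodule'_iSup]
    refine iSup_le fun m => ?_
    obtain ⟨e⟩ := m.2
    let g : θ.IntertwiningMap σ :=
      (Representation.IntertwiningMap.equivLinearMapAsModule θ σ).symm
        (m.1.subtype ∘ₗ e.symm.toLinearMap)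
    intro v hv
    rw [mem_toSubmodule_ofSubmodule'_iff] at hv
    refine range_le_repIsotypic θ σ g ⟨θ.asModuleEquiv (e ⟨σ.asModuleEquiv.symm v, hv⟩), ?_⟩
    change ((e.symm (e ⟨σ.asModuleEquiv.symm v, hv⟩) : m.1) : σ.asModule) = v
    rw [LinearEquiv.symm_apply_apply]
    rfl

/-- **Isotypic parts of pairwise non-isomorphic irreducibles are independent** (in any
representation `σ`): each `θᵢ`-part is `⊥` or an isotypic component of `σ.asModule`, distinct
indices giving distinct components, and the isotypic components of a module are independent
(Mathlib `sSupIndep_isotypicComponents`). [cite: Serre1977, §2.6 Thm. 8 (ii)] -/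
theorem iSupIndep_repIsotypic {ι : Type*} {W : ι → Type*} [∀ i, AddCommGroup (W i)]
    [∀ i, Module C (W i)] (θ : ∀ i, Representation C G (W i)) [∀ i, (θ i).IsIrreducible]
    (hθ : ∀ i j, Nonempty ((θ i).Equiv (θ j)) → i = j) (σ : Representation C G V) :
    iSupIndep fun i => repIsotypic (θ i) σ := by
  classical
  let P : ι → Submodule C[G] σ.asModule := fun i =>
    isotypicComponent C[G] σ.asModule (θ i).asModule
  have hP : (fun i => repIsotypic (θ i) σ) =
      fun i => (Subrepresentation.ofSubmodule' (P i)).toSubmodule :=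
    funext fun i => repIsotypic_eq_toSubmodule_isotypicComponent (θ i) σ
  rw [hP]
  apply iSupIndep.toSubmodule_ofSubmodule' σ
  -- a non-zero `θ`-isotypic component contains a copy of `θ.asModule`
  have hex : ∀ i, P i ≠ ⊥ →
      ∃ m : Submodule C[G] σ.asModule, Nonempty (m ≃ₗ[C[G]] (θ i).asModule) := by
    intro i hi
    by_contra h
    exact hi (sSup_eq_bot.mpr fun m hm =>
      absurd (⟨m, hm⟩ : ∃ m : Submodule C[G] σ.asModule, Nonempty (m ≃ₗ[C[G]] (θ i).asModule)) h)
  have hmem : ∀ i, P i ≠ ⊥ → P i ∈ isotypicComponents C[G] σ.asModule := by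
    intro i hi
    obtain ⟨m, ⟨e⟩⟩ := hex i hi
    haveI : IsSimpleModule C[G] m := IsSimpleModule.congr e
    exact ⟨m, inferInstance, (e.isotypicComponent_eq).symm⟩
  rw [← iSupIndep_ne_bot]
  let g : {i // P i ≠ ⊥} → isotypicComponents C[G] σ.asModule := fun i => ⟨P i.1, hmem i.1 i.2⟩
  have hg : Function.Injective g := by
    intro i j hij
    have hPij : P i.1 = P j.1 := congrArg Subtype.val hij
    apply Subtype.ext
    apply hθ
    obtain ⟨mi, ⟨ei⟩⟩ := hex i.1 i.2
    obtain ⟨mj, ⟨ej⟩⟩ := hex j.1 j.2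
    haveI : IsSimpleModule C[G] mi := IsSimpleModule.congr ei
    haveI : IsSimpleModule C[G] mj := IsSimpleModule.congr ej
    have hle : mi ≤ isotypicComponent C[G] σ.asModule mj := by
      rw [ej.isotypicComponent_eq]
      change mi ≤ P j.1
      rw [← hPij]
      change mi ≤ isotypicComponent C[G] σ.asModule (θ i.1).asModule
      rw [← ei.isotypicComponent_eq]
      exact mi.le_isotypicComponent
    obtain ⟨f⟩ := isIsotypicOfType_submodule_iff.mp
      (IsIsotypicOfType.isotypicComponent C[G] σ.asModule mj) mi hle
    exact ⟨Literature.RepresentationTheory.Semisimple.Representation.Equiv.ofAsModuleLinearEquiv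
      (ei.symm.trans (f.trans ej))⟩
  exact ((sSupIndep_iff _).mp (sSupIndep_isotypicComponents C[G] σ.asModule)).comp hg

/-- **Isotypic decomposition of a finite-dimensional semisimple representation.**  `V` is the
direct sum (`iSupIndep_repIsotypic`) of finitely many `θᵢ`-parts with `θᵢ` irreducible, pairwise
non-isomorphic, modelled on `Fin dᵢ → C`, each `θᵢ` a subrepresentation of `σ` up to isomorphism
(so `θᵢ(g) = 1` whenever `σ(g) = 1`): the `θᵢ` are simple submodules chosen in the finitely many
isotypic components of the Noetherian semisimple `C[G]`-module `σ.asModule`, whose sum is `⊤`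
(Mathlib `sSup_isotypicComponents`). [cite: Serre1977, §2.6 Thm. 8 (i)] -/
theorem exists_repIsotypic_iSup_eq_top {E : Type u} [AddCommGroup E] [Module C E]
    [FiniteDimensional C E] (σ : Representation C G E) [σ.IsSemisimpleRepresentation] :
    ∃ (ι : Type u) (_ : Fintype ι) (d : ι → ℕ) (θ : ∀ i, Representation C G (Fin (d i) → C)),
      (∀ i, (θ i).IsIrreducible) ∧ (∀ i j, Nonempty ((θ i).Equiv (θ j)) → i = j) ∧
      (∀ i g, σ g = 1 → θ i g = 1) ∧ ⨆ i, repIsotypic (θ i) σ = ⊤ := by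
  classical
  haveI : IsSemisimpleModule C[G] σ.asModule :=
    (Representation.isSemisimpleRepresentation_iff_isSemisimpleModule_asModule σ).mp ‹_›
  haveI : IsNoetherian C[G] σ.asModule :=
    isNoetherian_of_tower C (inferInstance : IsNoetherian C σ.asModule)
  let I : Set (Submodule C[G] σ.asModule) := isotypicComponents C[G] σ.asModule
  haveI : Fintype ↥I := Fintype.ofFinite _
  have hc : ∀ c : ↥I, ∃ S : Submodule C[G] σ.asModule,
      IsSimpleModule C[G] S ∧ c.1 = isotypicComponent C[G] σ.asModule S := fun c => c.2
  choose S hS hcS using hc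
  let T : ↥I → Subrepresentation σ := fun c => Subrepresentation.ofSubmodule' (S c)
  have hTirr : ∀ c, (T c).toRepresentation.IsIrreducible := fun c =>
    (Literature.RepresentationTheory.Semisimple.Subrepresentation.isIrreducible_toRepresentation_iff
      (T c)).mpr (hS c)
  let d : ↥I → ℕ := fun c => finrank C ↥(T c).toSubmodule
  let eB : ∀ c, ↥(T c).toSubmodule ≃ₗ[C] (Fin (d c) → C) := fun c =>
    (Module.finBasis C ↥(T c).toSubmodule).equivFun
  let θ : ∀ c, Representation C G (Fin (d c) → C) := fun c =>
    (T c).toRepresentation.ofLinearEquiv (eB c)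
  let eθ : ∀ c, (T c).toRepresentation.Equiv (θ c) := fun c =>
    Representation.Equiv.mk (eB c) fun g => LinearMap.ext fun v => by
      simp [θ, Representation.ofLinearEquiv_apply]
  have hθirr : ∀ c, (θ c).IsIrreducible := fun c => by
    haveI := hTirr c
    exact Literature.RepresentationTheory.Semisimple.Representation.isIrreducible_of_equiv (eθ c)
  -- `θ c` as a `C[G]`-module is the chosen simple submodule `S c`
  let eM : ∀ c, (θ c).asModule ≃ₗ[C[G]] ↥(S c) := fun c =>
    (Literature.RepresentationTheory.Semisimple.Representation.Equiv.asModuleLinearEquiv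
        (eθ c)).symm.trans
      (Literature.RepresentationTheory.Semisimple.Subrepresentation.asModuleEquiv (T c))
  have hrep : ∀ c, repIsotypic (θ c) σ = (Subrepresentation.ofSubmodule' c.1).toSubmodule := by
    intro c
    haveI := hθirr c
    rw [repIsotypic_eq_toSubmodule_isotypicComponent, (eM c).isotypicComponent_eq, ← hcS c]
  refine ⟨↥I, inferInstance, d, θ, hθirr, fun i j ⟨e⟩ => ?_, fun c g hg => ?_, ?_⟩
  · -- pairwise non-isomorphic: isomorphic simples have the same isotypic component
    apply Subtype.ext
    rw [hcS i, hcS j]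
    exact ((eM i).symm.trans
      ((Literature.RepresentationTheory.Semisimple.Representation.Equiv.asModuleLinearEquiv
        e).trans (eM j))).isotypicComponent_eq
  · -- `θ c` factors through `σ(G)`
    have hT : (T c).toRepresentation g = 1 := LinearMap.ext fun v => Subtype.ext (by
      change σ g (v : E) = v
      rw [hg, Module.End.one_apply])
    exact LinearMap.ext fun w => by simp [θ, Representation.ofLinearEquiv_apply, hT]
  · -- the parts sum to `V`
    simp_rw [hrep]
    rw [← toSubmodule_ofSubmodule'_iSup, ← sSup_eq_iSup', sSup_isotypicComponents,
      toSubmodule_ofSubmodule'_top]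

end Dictionary

/-! ### Semisimplicity of the restriction to inertia -/

section Maschke

variable {C : Type*} [Field C] [CharZero C]

/-- **Maschke for finite image** (any field of characteristic `0`): a representation `σ` of a
group `G` with `σ(G) ≤ GL(E)` finite is semisimple — its subrepresentations are those of the
finite group `σ(G)`, to which Mathlib's Maschke theorem applies. [cite: Serre1977, §1.3 Thm. 1] -/
theorem Representation.isSemisimpleRepresentation_of_finite_range_asGroupHom {G : Type*}
    [Group G] {E : Type*} [AddCommGroup E] [Module C E] (σ : Representation C G E)
    (hfin : (Set.range σ.asGroupHom).Finite) : σ.IsSemisimpleRepresentation := by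
  let H : Subgroup (E →ₗ[C] E)ˣ := σ.asGroupHom.range
  haveI : Finite H := by
    have : (H : Set (E →ₗ[C] E)ˣ).Finite := by
      rw [MonoidHom.coe_range]; exact hfin
    exact this.to_subtype
  haveI : NeZero (Nat.card H : C) := ⟨Nat.cast_ne_zero.mpr Nat.card_pos.ne'⟩
  let σH : Representation C H E := (Units.coeHom (E →ₗ[C] E)).comp H.subtype
  let e : Subrepresentation σ ≃o Subrepresentation σH :=
    { toFun := fun W ↦ ⟨W.toSubmodule, fun h v hv ↦ by
        obtain ⟨g, hg⟩ := h.2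
        have : σH h = σ g := by
          change ((h : (E →ₗ[C] E)ˣ) : E →ₗ[C] E) = σ g
          rw [← hg, Representation.asGroupHom_apply]
        rw [this]
        exact W.apply_mem_toSubmodule g hv⟩
      invFun := fun W ↦ ⟨W.toSubmodule, fun g v hv ↦ by
        have : σ g = σH ⟨σ.asGroupHom g, g, rfl⟩ := by
          change σ g = ((σ.asGroupHom g : (E →ₗ[C] E)ˣ) : E →ₗ[C] E)
          rw [Representation.asGroupHom_apply]
        rw [this]
        exact W.apply_mem_toSubmodule _ hv⟩
      left_inv := fun W ↦ by ext; rfl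
      right_inv := fun W ↦ by ext; rfl
      map_rel_iff' := Iff.rfl }
  exact e.complementedLattice_iff.mpr inferInstance

end Maschke

end Literature.NumberTheory.GaloisRepresentations

end
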